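import Summits.Ventures.PercRepro.C041BlockMapCoresPure
import Summits.Ventures.PercRepro.C041BlockMapTriangleBridge
import Summits.Ventures.PercRepro.C041BlockMapOneExit
import Summits.Ventures.PercRepro.C041RelaxedTriangleMain

/-!
# ROW C-041 — DOMINATION BY THE TRIANGLE, I: `K₄` (p6, gen 39; P6-TWOEXIT-LEAN.md §51)

THE IDENTITY (`thetaK4_eq_dom`): the block map of `K₄` with two exits (`thetaK4`, the 64-colouring closed form of
`C041BlockMapFourCores` / `C041BlockMapCoresPure`) is FOUR TRIANGLES PLUS MANIFEST CONE TERMS,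
  `Θ_{K₄}(w, w′) = 4·θ_△(w, w′) + 2·ℓψ(w w′) + 2·ℓψ(w)·w′ + 2·w·ℓψ(w′) + 20·w w′`.
The reason is the complementation symmetry of the statuses: of the 64 colourings of `K₄`, 10 are `BB`, 6 `BX`, 6 `XB`, 20 `XX`,
6 `RX`, 6 `XR`, 6 «both separated, one sub-zone» and 4 «both separated, apart» (`B` = merged unreached, `X` = merged reached,
`R` = separated reached); the triangle has `(2, 1, 1, 0, 1, 1, 1, 1)`, and what is left after four triangles pairs up as
`θ_B + θ_R = ℓψ` (`thB_add_thR`).  CONSEQUENCES for two CONE zones `w`, `w′` at the exits: (i) (P) and the ZONE O-CUBE hold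
at the output of `K₄` (`K4v_thetaK4_of_InCone`, `zoneOCube_thetaK4_of_InCone`) — from THEOREM (RELAXED TRIANGLE)
(`K4v_thetaTri_of_InCone`), the closure of the cone under products (`InCone.mul`) and under `ℓψ` (`inCone_ellv`), and the
convexity of `K4v`; the relaxed domain `Rel` is NOT an invariant of `K₄` (`not_relaxed_K4`, gen 38), and no tightened invariant is
needed for cone inputs; (ii) CONJECTURE (BLOCK MAP) FOR `K₄` FOLLOWS FROM THE TRIANGLE'S (`InCone_thetaK4_of_thetaTri`,
`coneHost_k4_of_tri`, `coneHost_k4_of_thetaTri_pure`): `K₄` is a cone host as soon as the triangle is.  The helper lemmas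
`K4v_add`, `K4v_smul`, `InCone_nAdm_smul_one` are the convexity of (P) on six-vectors and the cone membership of `n(w)·1`.
Twin (own code, exact rationals): the identity on 40 random rational inputs and the type counts by the block map from its definition.
-/

namespace PercRepro

namespace ZoneZ

namespace MultiExit

open TreeClosure RelaxedTriangle

/-! ## (P) is a convex cone on six-vectors -/

/-- (P) is closed under addition of six-vectors. -/
theorem K4v_add {x y : Vec6} (hx : K4v x) (hy : K4v y) : K4v (x + y) := by
  unfold K4v at *
  have := hx.add hy
  convert this using 1 <;> simp only [Pi.add_apply] <;> ring

/-- (P) is closed under non-negative scaling of six-vectors. -/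
theorem K4v_smul {x : Vec6} (hx : K4v x) {c : ℝ} (hc : 0 ≤ c) : K4v (c • x) := by
  unfold K4v at *
  have := hx.smul hc
  convert this using 1 <;> simp only [Pi.smul_apply, smul_eq_mul] <;> ring

/-- `n(w) • 1` lies in the cone for every cone member `w` (a separated, unreached exit). -/
theorem InCone_nAdm_smul_one {w : Vec6} (hw : InCone w) : InCone (nAdm w • (1 : Vec6)) :=
  InCone_one.smul (nAdm w) (nAdm_nonneg hw)

/-! ## THE `K₄` DOMINATION IDENTITY -/

/-- **`Θ_{K₄} = 4 θ_△ + 2 ℓψ(w w′) + 2 ℓψ(w) w′ + 2 w ℓψ(w′) + 20 w w′`.** -/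
theorem thetaK4_eq_dom (w w' : Vec6) :
    thetaK4 w w' = (4 : ℝ) • thetaTri w w' + (2 : ℝ) • ellv (w * w') + (2 : ℝ) • (ellv w * w')
      + (2 : ℝ) • (w * ellv w') + (20 : ℝ) • (w * w') := by
  ext i
  simp only [thetaK4, thetaTri_eq_sum, Pi.add_apply, Pi.mul_apply, Pi.smul_apply, smul_eq_mul, thB, thR, ellv, ell,
    nAdm, kInv]
  fin_cases i <;> simp <;> ring

/-- The manifest part of `Θ_{K₄}` lies in the cone for cone inputs. -/
theorem InCone_k4_rest {w w' : Vec6} (hw : InCone w) (hw' : InCone w') :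
    InCone ((2 : ℝ) • ellv (w * w') + (2 : ℝ) • (ellv w * w') + (2 : ℝ) • (w * ellv w') + (20 : ℝ) • (w * w')) :=
  ((((inCone_ellv (hw.mul hw')).smul 2 (by norm_num)).add (((inCone_ellv hw).mul hw').smul 2 (by norm_num))).add
    ((hw.mul (inCone_ellv hw')).smul 2 (by norm_num))).add ((hw.mul hw').smul 20 (by norm_num))

/-! ## (P) at `K₄` with two cone zones — a theorem -/

/-- **THEOREM (`K₄`, cone inputs)**: the core `K₄` carrying two cone zones at its exits satisfies (P) at the output. -/
theorem K4v_thetaK4_of_InCone {w w' : Vec6} (hw : InCone w) (hw' : InCone w') : K4v (thetaK4 w w') := by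
  rw [thetaK4_eq_dom, add_assoc, add_assoc, add_assoc, ← add_assoc ((2 : ℝ) • ellv (w * w')),
    ← add_assoc ((2 : ℝ) • ellv (w * w') + _)]
  exact K4v_add (K4v_smul (K4v_thetaTri_of_InCone hw hw') (by norm_num)) (K4v_of_InCone (InCone_k4_rest hw hw'))

/-- The ZONE O-CUBE at the output of `K₄` with two cone zones: `2F ≤ T₁ + T₂ + 2I`. -/
theorem zoneOCube_thetaK4_of_InCone {w w' : Vec6} (hw : InCone w) (hw' : InCone w') :
    0 ≤ (thetaK4 w w' 1 - thetaK4 w w' 0) + (thetaK4 w w' 2 - thetaK4 w w' 0)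
      + 2 * (thetaK4 w w' 4 + thetaK4 w w' 5 - thetaK4 w w' 3) - 2 * thetaK4 w w' 0 :=
  zoneOCube_nonneg_of_K4 (K4v_thetaK4_of_InCone hw hw')

/-! ## CONJECTURE (BLOCK MAP) for `K₄` reduces to the triangle -/

/-- If `θ_△` maps cone × cone into the cone, so does `Θ_{K₄}`. -/
theorem InCone_thetaK4_of_thetaTri (h : ∀ X Y : Vec6, InCone X → InCone Y → InCone (thetaTri X Y))
    {w w' : Vec6} (hw : InCone w) (hw' : InCone w') : InCone (thetaK4 w w') := by
  rw [thetaK4_eq_dom, add_assoc, add_assoc, add_assoc, ← add_assoc ((2 : ℝ) • ellv (w * w')),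
    ← add_assoc ((2 : ℝ) • ellv (w * w') + _)]
  exact ((h w w' hw hw').smul 4 (by norm_num)).add (InCone_k4_rest hw hw')

/-- **THEOREM (`K₄` ⟸ TRIANGLE)**: `K₄` with two exits is a cone host as soon as the triangle host is. -/
theorem coneHost_k4_of_tri (h : ConeHost tri triExit 0) : ConeHost k4 (ex2 1 2) 0 :=
  coneHost_k4_iff.2 fun _ _ hX hY => InCone_thetaK4_of_thetaTri (coneHost_tri_iff.1 h) hX hY

/-- The seed programme's target gives `K₄`: if `θ_△ (V a) (V b)` lies in the cone for all pure inputs, `K₄` is a cone host. -/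
theorem coneHost_k4_of_thetaTri_pure
    (h : ∀ {m m' : ℕ} (a : Fin m → ℝ) (b : Fin m' → ℝ), (∀ i, 0 ≤ a i ∧ a i ≤ 1) → (∀ j, 0 ≤ b j ∧ b j ≤ 1) →
      InCone (thetaTri (V a) (V b))) : ConeHost k4 (ex2 1 2) 0 :=
  coneHost_k4_of_tri (coneHost_tri_iff_pure.2 h)

end MultiExit

end ZoneZ

end PercRepro
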